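import Summits.CriticalPhenomena.PercolationContinuityZ3.Theorems.PercNearOneGluingNoHeavyLowerTailNineTypeLabelCert

/-!
# The single-source packing minus one term: the two six-term laws that label certificates still reach (all `n`)

Support file for crux `stmt-CriticalPhenomena-4575` (master-family programme; Conjecture W for the quadratic four-point row
`Q44`), seat `prim-bnk-1` gen 27; memo `run/shared/lean/prim/prim-l12/FROM-prim-bnk-1-gen27-SINGLE-SOURCE-ANATOMY.md` §3.

The SINGLE-SOURCE PACKING at the terminal `a` (gen 26 §4e) is the seven-term inequality
`P(ab|cy)[P(ac|by)+P(ay|bc)] + P(ab|c|y)P(ay|bc) + P(ab|c|y)P(a|b|cy) + P(ay|bc)P(a|b|cy) + [P(ab|c|y)+P(ac|b|y)]·P(a|bcy)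
 ≤ [P(ab|cy)+P(abcy)]·P(a|b|c|y)` — the five weight-two kinds `K1, K2, K4, K5, K4s` of `Q44` together with BOTH darts of
source `a`.  It holds in every tested fibre (kit j176076) but carries NO nine-type label certificate (gen 26; gen 27 memo §3:
an exhaustive scan of the 64 sub-type-sets determines the
certifiable ones, the minimal non-certifiable ones being `K1+K5+K4s+ab+ac` and `K2+K5+K4s+ab+ac`).  This file lands the two
MAXIMAL certifiable approximations — the single-source law with the `K4s` term, resp. the `K5` term, removed — so that the
tree records exactly where the table method stops and the kernel method (memo §4–§5, `…Q44OddContainment`) must take over: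

* `pack_singleSource_a_minus_K4s`:
  `P(ab|cy)P(ac|by) + P(ab|cy)P(ay|bc) + P(ab|c|y)P(ay|bc) + P(ab|c|y)P(a|b|cy) + P(ab|c|y)P(a|bcy) + P(a|bcy)P(ac|b|y) ≤ [P(ab|cy)+P(abcy)]·P(∅)`;
* `pack_singleSource_a_minus_K5`:
  `P(ab|cy)P(ac|by) + P(ab|cy)P(ay|bc) + P(ab|c|y)P(ay|bc) + P(a|b|cy)P(ay|bc) + P(a|bcy)P(ab|c|y) + P(a|bcy)P(ac|b|y) ≤ [P(ab|cy)+P(abcy)]·P(∅)`.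

Cells are indexed as in `FourPointAtoms.pat4` (`0 = a|b|c|y, 1 = a|b|cy, 5 = ac|b|y, 6 = ab|c|y, 7 = a|bcy, 8 = ay|bc, 9 = ac|by,
11 = ab|cy, 14 = abcy`).  Pure table checks (`decide`) + `linarith`; no named facts, no sorries, standard axioms.
-/

namespace Summit.CriticalPhenomena.PercolationContinuityZ3.Theorems

namespace TwoCopyMono

open Finset FourPointAtoms

variable {n : ℕ}

/-- Table check for the single-source family at `a` without the `K4s` point: (heavy, light, label) =
(ab|cy, ac|by, 1), (ab|cy, ay|bc, 1), (ab|c|y, ay|bc, 1), (ab|c|y, a|b|cy, 7), (ab|c|y, a|bcy, 7), (a|bcy, ac|b|y, 8). [this work] -/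
theorem tableOK_singleSource_a_minus_K4s :
    tableOK ({(11, 9), (11, 8), (6, 8), (6, 1), (6, 7), (7, 5)} : Finset (Fin 15 × Fin 15))
      (fun p => if p = (11, 9) then 1 else if p = (11, 8) then 1 else if p = (6, 8) then 1 else
        if p = (6, 1) then 7 else if p = (6, 7) then 7 else 8) := by
  decide +kernel

/-- **Packing, all `n`** (single-source family at `a` without the `K4s` term):
`P(ab|cy)P(ac|by) + P(ab|cy)P(ay|bc) + P(ab|c|y)P(ay|bc) + P(ab|c|y)P(a|b|cy) + P(ab|c|y)P(a|bcy) + P(a|bcy)P(ac|b|y)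
 ≤ [P(ab|cy)+P(abcy)]·P(a|b|c|y)` on every finite weighted graph. [this work] -/
theorem pack_singleSource_a_minus_K4s (w : Sym2 (Fin n) → unitInterval) (a b c y : Fin n) :
    cell w a b c y 11 * cell w a b c y 9 +
      cell w a b c y 11 * cell w a b c y 8 +
      cell w a b c y 6 * cell w a b c y 8 +
      cell w a b c y 6 * cell w a b c y 1 +
      cell w a b c y 6 * cell w a b c y 7 +
      cell w a b c y 7 * cell w a b c y 5 ≤
      (cell w a b c y 11 + cell w a b c y 14) * cell w a b c y 0 := by
  have h := pack_of_tableOK _ _ tableOK_singleSource_a_minus_K4s w a b c y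
  rw [Finset.sum_insert (by decide), Finset.sum_insert (by decide), Finset.sum_insert (by decide),
    Finset.sum_insert (by decide), Finset.sum_insert (by decide), Finset.sum_singleton] at h
  dsimp only at h
  linarith

/-- Table check for the single-source family at `a` without the `K5` point: (heavy, light, label) =
(ab|cy, ac|by, 7), (ab|cy, ay|bc, 5), (ab|c|y, ay|bc, 5), (a|b|cy, ay|bc, 6), (a|bcy, ab|c|y, 8), (a|bcy, ac|b|y, 1). [this work] -/
theorem tableOK_singleSource_a_minus_K5 :
    tableOK ({(11, 9), (11, 8), (6, 8), (1, 8), (7, 6), (7, 5)} : Finset (Fin 15 × Fin 15))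
      (fun p => if p = (11, 9) then 7 else if p = (11, 8) then 5 else if p = (6, 8) then 5 else
        if p = (1, 8) then 6 else if p = (7, 6) then 8 else 1) := by
  decide +kernel

/-- **Packing, all `n`** (single-source family at `a` without the `K5` term):
`P(ab|cy)P(ac|by) + P(ab|cy)P(ay|bc) + P(ab|c|y)P(ay|bc) + P(a|b|cy)P(ay|bc) + P(a|bcy)P(ab|c|y) + P(a|bcy)P(ac|b|y)
 ≤ [P(ab|cy)+P(abcy)]·P(a|b|c|y)` on every finite weighted graph. [this work] -/
theorem pack_singleSource_a_minus_K5 (w : Sym2 (Fin n) → unitInterval) (a b c y : Fin n) :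
    cell w a b c y 11 * cell w a b c y 9 +
      cell w a b c y 11 * cell w a b c y 8 +
      cell w a b c y 6 * cell w a b c y 8 +
      cell w a b c y 1 * cell w a b c y 8 +
      cell w a b c y 7 * cell w a b c y 6 +
      cell w a b c y 7 * cell w a b c y 5 ≤
      (cell w a b c y 11 + cell w a b c y 14) * cell w a b c y 0 := by
  have h := pack_of_tableOK _ _ tableOK_singleSource_a_minus_K5 w a b c y
  rw [Finset.sum_insert (by decide), Finset.sum_insert (by decide), Finset.sum_insert (by decide),
    Finset.sum_insert (by decide), Finset.sum_insert (by decide), Finset.sum_singleton] at h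
  dsimp only at h
  linarith

end TwoCopyMono

end Summit.CriticalPhenomena.PercolationContinuityZ3.Theorems
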